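import Mathlib.Analysis.Matrix.Normed

/-!
# `BalabanUV.Beta.GAN24.DerivativeRateTransferJensenMassFreePolarNear` — binder row G-an2-4 ∕ (CONV-C), route R6 «VALUES, NOT DERIVATIVES», PART 66:
# THE POLAR FACTOR NEAR A SECOND ORTHOGONAL LINK — if `R′` is the polar link of `M` (`R′ᵀR′ = 1`, `M·R′ᵀ` symmetric positive semidefinite, PART 58)
# and `R_B` is ANY orthogonal matrix, then with `E := M·R_Bᵀ − 1` (Frobenius norm `‖·‖`):
#   `‖R′ − R_B‖ ≤ 2‖E‖`   and   `‖R′ − R_B‖ ≤ ½‖E − Eᵀ‖ + 4‖E‖²`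
# — the discrepancy between the polar convention and a second convention is controlled by the SKEW part of `M·R_Bᵀ` to first order and by
# `‖M·R_Bᵀ − 1‖` only to SECOND order (unit b2b-balaban-gan24-p3, gen 45; v1)

NOT IN PRINT; OUR PROOF (for the ROUTE; [folklore] finite-dimensional linear algebra over `ℝ` with Mathlib's scoped Frobenius norm
`Matrix.Norms.Frobenius`: trace form `tr(AᵀB) ≤ ‖A‖‖B‖`, `tr(P·W) ≤ tr P` for `P ⪰ 0` symmetric and `W` orthogonal, orthogonal invariance).
HONEST FRAMING (cell contract, verbatim): «discharging `BetaPertH` makes Bałaban's UV stability UNCONDITIONAL — a real constructive-QFT result; it is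
NOT the continuum limit and NOT the Clay problem.»  HONEST DEPENDENCY (verbatim): «continuum YM on T⁴ ⇐ BetaPertH ∧ nine spine estimates (0/9 proved);
BetaPertH ⇐ (D1) ∧ (D4) ∧ CAP+tail; G-an2-4 gates asym, D1 and NE2/3/4.»

WHY THIS FILE.  PART 56 (`DerivativeRateTransferJensenMassFreeTransfer`) transfers the polar pair's `δ = 0` END to a SECOND coarse connection `R″`
within `τ` of the polar link `R′` (`|(R″ − R′)w|² ≤ τ²|w|²`) at the price `δ = (1+s⁻¹)·τ²·w_c·d′`; the pricing desk books the SIZE of `τ` for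
Bałaban–Jaffe's other printed conventions [Erice 1985, p. 221: (1.26) Wilson ∕ polar `Proj(L^{−d}Σ_x U(Γ_x))`, (1.27) Federbush's minimiser of
`Σ_x dist²(U(Γ_x), V)`, (1.28) `exp[L^{−d}Σ_x ln(U(Γ_x)U(yy′)⁻¹)]·U(yy′)`] as «τ PAPER» (PRICING-GAN24 v3.56 C-R6°; gan24-idea-1 g57 LENS ITEM 14 (B)
«ρ ≍ Δ³»).  The desk's consequence ledger needs the THIRD order: with `τ ≍ p̂³` and `s = p̂` the transferred additive slack is `δ ≍ p̂⁵ ≪ l^{−2d}` in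
`d = 4` class-T units, whereas `τ ≍ p̂²` would give `δ ≍ p̂³`, short.  THIS FILE is the algebraic half of that third-order estimate: the polar link and a
second orthogonal link `R_B` differ, in Frobenius norm, by at most HALF THE SKEW PART of `E = M·R_Bᵀ − 1` plus `4‖E‖²`.  PART 67 supplies the
analytic half (for `R_B = exp(Σ_x q_x A_x)·τ₀`, the (1.28)-type link of Lie-algebra data `A_x` of size `s`, `‖E‖ ≤ s² + (5∕2)s³` and `‖E − Eᵀ‖ ≤ 5s³`)
and PART 68 assembles `τ ≤ (5∕2)s³ + 49s⁴`.

THE ARGUMENT (U := R′R_Bᵀ, G := M R_Bᵀ = 1 + E, so `G·Uᵀ = M·R′ᵀ ⪰ 0` symmetric, `UᵀU = 1`, `Y := U − 1`).  (i) For `P ⪰ 0` symmetric and `W`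
orthogonal, `tr P − tr(PW) = ½·tr((1−W)P(1−W)ᵀ) ≥ 0`; with `P = GUᵀ`, `W = U`: `tr G ≤ tr(GUᵀ)`, i.e. `0 ≤ tr(G Yᵀ) = tr Y + tr(YᵀE)`; orthogonality
gives `Y + Yᵀ = −YᵀY`, so `tr Y = −½‖Y‖²`, whence `‖Y‖² ≤ 2 tr(YᵀE) ≤ 2‖Y‖‖E‖` and **`‖Y‖ ≤ 2‖E‖`**.  (ii) Symmetry of `GUᵀ` reads
`Y − Yᵀ = (E − Eᵀ) + (EYᵀ − YEᵀ)`, so `2Y = (E − Eᵀ) + (EYᵀ − YEᵀ) − YᵀY` and **`‖Y‖ ≤ ½‖E − Eᵀ‖ + ‖E‖‖Y‖ + ½‖Y‖² ≤ ½‖E − Eᵀ‖ + 4‖E‖²`**.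
(iii) `R′ − R_B = Y·R_B` and the Frobenius norm is orthogonally invariant.

WHAT THIS FILE PROVES (0 sorry, 0 `def`, nothing cited; `o` finite, real matrices, `‖·‖` = Mathlib's scoped Frobenius norm):
* §1 toolkit: `frob_norm_sq` (`‖A‖² = Σ A_ij²`), `trace_transpose_mul_eq_sum`, `trace_transpose_mul_self`, `trace_transpose_mul_le` (Cauchy–Schwarz),
  `trace_conj_transpose_nonneg` (`tr(BPBᵀ) ≥ 0` for a PSD form `P`), `trace_mul_le_trace_of_orthogonal` (`tr(PW) ≤ tr P`), `frob_norm_mul_orthogonal`,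
  `frob_norm_orthogonal_mul`, `mulVec_dotProduct_self_le_frob` (`|Aw|² ≤ ‖A‖²|w|²`).
* §2 **`frob_norm_sub_one_le_two_mul`** (`‖U − 1‖ ≤ 2‖G − 1‖`), **`frob_norm_sub_one_le_skew_add_sq`** (`‖U − 1‖ ≤ ½‖E − Eᵀ‖ + 4‖E‖²`).
* §3 **`frob_norm_polar_sub_le_two_mul`**, **`frob_norm_polar_sub_le`** (the base-changed forms for `R′` polar of `M` and any orthogonal `R_B`,
  `E = M·R_Bᵀ − 1`), **`mulVec_polar_sub_sq_le`** (PART 56's letter shape: `|(R′ − R_B)w|² ≤ (½‖E − Eᵀ‖ + 4‖E‖²)²·|w|²`).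
WHAT IT DOES NOT DO: expand `E` for any particular `R_B` (PART 67), prove that the polar factor exists (PART 58), instantiate anything of Bałaban's, or
claim (CONS) ∕ exact (STAB).  SUPPLIER work on route R6 (rank 2, REDUCTION, no seat); no consumer of record; NEVER «G-an2-4 closed»; NOT (CONV-C), NOT
D1, NOT `BetaPertH`, NOT continuum, NOT Clay.  Records: `HOME/b2b-balaban-gan24-p3/WOODBURY-FIBRE.md` v14.5. -/

noncomputable section

open scoped Matrix Matrix.Norms.Frobenius
open Finset Matrix

namespace Summit.QuantumFields.BalabanUV.Beta.GAN24.DerivativeRateTransferJensenMassFreePolarNear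

variable {o : Type*} [Fintype o] [DecidableEq o]

/-! ## §1 Frobenius ∕ trace toolkit over `ℝ` -/

/-- `‖A‖² = Σ_{i,j} A_ij²` for the Frobenius norm. [folklore] -/
theorem frob_norm_sq (A : Matrix o o ℝ) : ‖A‖ ^ 2 = ∑ i, ∑ j, A i j ^ 2 := by
  rw [Matrix.frobenius_norm_def, ← Real.sqrt_eq_rpow,
    Real.sq_sqrt (Finset.sum_nonneg fun i _ => Finset.sum_nonneg fun j _ => by positivity)]
  refine Finset.sum_congr rfl fun i _ => Finset.sum_congr rfl fun j _ => ?_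
  rw [Real.rpow_two, Real.norm_eq_abs, sq_abs]

omit [DecidableEq o] in
/-- `tr(AᵀB) = Σ_{i,j} A_ij B_ij`. [folklore] -/
theorem trace_transpose_mul_eq_sum (A B : Matrix o o ℝ) : trace (Aᵀ * B) = ∑ i, ∑ j, A i j * B i j := by
  simp only [Matrix.trace, Matrix.diag, Matrix.mul_apply, Matrix.transpose_apply]
  rw [Finset.sum_comm]

/-- `tr(AᵀA) = ‖A‖²`. [folklore] -/
theorem trace_transpose_mul_self (A : Matrix o o ℝ) : trace (Aᵀ * A) = ‖A‖ ^ 2 := by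
  rw [trace_transpose_mul_eq_sum, frob_norm_sq]
  simp only [sq]

/-- Cauchy–Schwarz for the trace form: `tr(AᵀB) ≤ ‖A‖·‖B‖`. [folklore] -/
theorem trace_transpose_mul_le (A B : Matrix o o ℝ) : trace (Aᵀ * B) ≤ ‖A‖ * ‖B‖ := by
  rw [trace_transpose_mul_eq_sum]
  have hsq : (∑ i, ∑ j, A i j * B i j) ^ 2 ≤ (‖A‖ * ‖B‖) ^ 2 := by
    rw [mul_pow, frob_norm_sq, frob_norm_sq, ← Fintype.sum_prod_type', ← Fintype.sum_prod_type', ← Fintype.sum_prod_type']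
    exact Finset.sum_mul_sq_le_sq_mul_sq _ _ _
  exact (le_abs_self _).trans (abs_le_of_sq_le_sq hsq (mul_nonneg (norm_nonneg _) (norm_nonneg _)))

omit [DecidableEq o] in
/-- for a positive semidefinite FORM `P` (`0 ≤ ⟨w, Pw⟩` for all `w`) and any `B`: `0 ≤ tr(B·P·Bᵀ)` (`= Σ_i ⟨b_i, P b_i⟩` over the rows `b_i` of `B`). [folklore] -/
theorem trace_conj_transpose_nonneg {P : Matrix o o ℝ} (hP : ∀ w : o → ℝ, 0 ≤ w ⬝ᵥ (P *ᵥ w)) (B : Matrix o o ℝ) :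
    0 ≤ trace (B * P * Bᵀ) := by
  have h : ∀ i, (B * P * Bᵀ) i i = (B i) ⬝ᵥ (P *ᵥ B i) := by
    intro i
    simp only [Matrix.mul_apply, Matrix.transpose_apply, dotProduct, Matrix.mulVec, Finset.sum_mul, Finset.mul_sum]
    rw [Finset.sum_comm]
    exact Finset.sum_congr rfl fun j _ => Finset.sum_congr rfl fun k _ => by ring
  simp only [Matrix.trace, Matrix.diag, h]
  exact Finset.sum_nonneg fun i _ => hP (B i)

/-- for a symmetric positive semidefinite form `P` and an orthogonal `W` (`WᵀW = 1`): `tr(P·W) ≤ tr P`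
(`tr P − tr(PW) = ½·tr((1 − W)·P·(1 − W)ᵀ) ≥ 0`). [folklore] -/
theorem trace_mul_le_trace_of_orthogonal {P W : Matrix o o ℝ} (hPt : Pᵀ = P) (hP : ∀ w : o → ℝ, 0 ≤ w ⬝ᵥ (P *ᵥ w))
    (hW : Wᵀ * W = 1) : trace (P * W) ≤ trace P := by
  have h0 := trace_conj_transpose_nonneg hP (1 - W)
  -- `(1 − W)P(1 − W)ᵀ = P − WP − PWᵀ + WPWᵀ`
  have e : (1 - W) * P * (1 - W)ᵀ = P - W * P - P * Wᵀ + W * P * Wᵀ := by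
    rw [transpose_sub, transpose_one]
    noncomm_ring
  have t1 : trace (W * P * Wᵀ) = trace P := by
    rw [Matrix.mul_assoc, Matrix.trace_mul_comm, Matrix.mul_assoc, hW, Matrix.mul_one]
  have t2 : trace (P * Wᵀ) = trace (P * W) := by
    rw [← Matrix.trace_transpose, transpose_mul, transpose_transpose, hPt, Matrix.trace_mul_comm]
  have t3 : trace (W * P) = trace (P * W) := Matrix.trace_mul_comm W P
  rw [e, trace_add, trace_sub, trace_sub, t1, t2, t3] at h0
  linarith

/-- orthogonal invariance on the right: `‖A·W‖ = ‖A‖` when `W·Wᵀ = 1`. [folklore] -/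
theorem frob_norm_mul_orthogonal (A : Matrix o o ℝ) {W : Matrix o o ℝ} (hW : W * Wᵀ = 1) : ‖A * W‖ = ‖A‖ := by
  have h : ‖A * W‖ ^ 2 = ‖A‖ ^ 2 := by
    rw [← trace_transpose_mul_self, ← trace_transpose_mul_self, transpose_mul, Matrix.mul_assoc, Matrix.trace_mul_comm,
      Matrix.mul_assoc, Matrix.mul_assoc, hW, Matrix.mul_one]
  exact (sq_eq_sq₀ (norm_nonneg _) (norm_nonneg _)).mp h

/-- orthogonal invariance on the left: `‖W·A‖ = ‖A‖` when `Wᵀ·W = 1`. [folklore] -/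
theorem frob_norm_orthogonal_mul (A : Matrix o o ℝ) {W : Matrix o o ℝ} (hW : Wᵀ * W = 1) : ‖W * A‖ = ‖A‖ := by
  have h : ‖W * A‖ ^ 2 = ‖A‖ ^ 2 := by
    rw [← trace_transpose_mul_self, ← trace_transpose_mul_self, transpose_mul, Matrix.mul_assoc, ← Matrix.mul_assoc Wᵀ, hW,
      Matrix.one_mul]
  exact (sq_eq_sq₀ (norm_nonneg _) (norm_nonneg _)).mp h

/-- the operator bound by the Frobenius norm: `|A·w|² ≤ ‖A‖²·|w|²`. [folklore] -/
theorem mulVec_dotProduct_self_le_frob (A : Matrix o o ℝ) (w : o → ℝ) :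
    (A *ᵥ w) ⬝ᵥ (A *ᵥ w) ≤ ‖A‖ ^ 2 * (w ⬝ᵥ w) := by
  rw [frob_norm_sq, Finset.sum_mul]
  refine Finset.sum_le_sum fun i _ => ?_
  have h := Finset.sum_mul_sq_le_sq_mul_sq (Finset.univ : Finset o) (fun j => A i j) (fun j => w j)
  simp only [Matrix.mulVec, dotProduct] at h ⊢
  calc (∑ j, A i j * w j) * ∑ j, A i j * w j = (∑ j, A i j * w j) ^ 2 := (sq _).symm
    _ ≤ (∑ j, A i j ^ 2) * ∑ j, w j ^ 2 := h
    _ = (∑ j, A i j ^ 2) * ∑ j, w j * w j := by simp only [sq]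

/-! ## §2 The polar factor of a matrix near the identity -/

/-- **`frob_norm_sub_one_le_two_mul` — A PRIORI: THE POLAR FACTOR OF `G` IS WITHIN `2‖G − 1‖` OF `1`** [folklore; our proof].  If `U` is orthogonal
and `G·Uᵀ` is symmetric positive semidefinite (i.e. `U` is the polar factor of `G`), then `‖U − 1‖ ≤ 2‖G − 1‖`. -/
theorem frob_norm_sub_one_le_two_mul {G U : Matrix o o ℝ} (hU : Uᵀ * U = 1) (hsym : (G * Uᵀ)ᵀ = G * Uᵀ)
    (hpsd : ∀ w : o → ℝ, 0 ≤ w ⬝ᵥ ((G * Uᵀ) *ᵥ w)) : ‖U - 1‖ ≤ 2 * ‖G - 1‖ := by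
  -- `tr G = tr((GUᵀ)U) ≤ tr(GUᵀ)`
  have h1 : trace G ≤ trace (G * Uᵀ) := by
    have h := trace_mul_le_trace_of_orthogonal hsym hpsd hU
    rwa [Matrix.mul_assoc, hU, Matrix.mul_one] at h
  -- `tr(GUᵀ) − tr G = tr(U − 1) + tr((U − 1)ᵀ(G − 1))`
  have h2 : trace (G * Uᵀ) - trace G = trace (U - 1) + trace ((U - 1)ᵀ * (G - 1)) := by
    rw [Matrix.trace_mul_comm (U - 1)ᵀ (G - 1), ← Matrix.trace_transpose (U - 1), ← trace_sub, ← trace_add]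
    congr 1
    rw [transpose_sub, transpose_one]
    noncomm_ring
  -- orthogonality: `tr(U − 1) = −½‖U − 1‖²`
  have h3 : trace (U - 1) = -(1 / 2) * ‖U - 1‖ ^ 2 := by
    have e : (U - 1)ᵀ * (U - 1) = -((U - 1)ᵀ + (U - 1)) := by
      rw [transpose_sub, transpose_one]
      have : Uᵀ * U - Uᵀ - U + 1 = -(Uᵀ - 1 + (U - 1)) := by rw [hU]; noncomm_ring
      calc (Uᵀ - 1) * (U - 1) = Uᵀ * U - Uᵀ - U + 1 := by noncomm_ring
        _ = -(Uᵀ - 1 + (U - 1)) := this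
    have ht : trace ((U - 1)ᵀ * (U - 1)) = -(2 * trace (U - 1)) := by
      rw [e, trace_neg, trace_add, Matrix.trace_transpose, two_mul]
    rw [trace_transpose_mul_self] at ht
    linarith
  have h4 := trace_transpose_mul_le (U - 1) (G - 1)
  -- `‖Y‖² ≤ 2‖Y‖‖E‖` ⟹ `(‖Y‖ − ‖E‖)² ≤ ‖E‖²` ⟹ `‖Y‖ ≤ 2‖E‖`
  have h5 : ‖U - 1‖ ^ 2 ≤ 2 * (‖U - 1‖ * ‖G - 1‖) := by nlinarith
  have h6 : (‖U - 1‖ - ‖G - 1‖) ^ 2 ≤ ‖G - 1‖ ^ 2 := by nlinarith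
  have h7 := abs_le_of_sq_le_sq h6 (norm_nonneg _)
  linarith [le_abs_self (‖U - 1‖ - ‖G - 1‖)]

/-- **`frob_norm_sub_one_le_skew_add_sq` — THE POLAR FACTOR OF `1 + E` IS `1` UP TO HALF THE SKEW PART OF `E` AND `4‖E‖²`** [folklore; our proof].
If `U` is orthogonal and `(1 + E)·Uᵀ` is symmetric positive semidefinite, then `‖U − 1‖ ≤ ½·‖E − Eᵀ‖ + 4·‖E‖²`. -/
theorem frob_norm_sub_one_le_skew_add_sq {E U : Matrix o o ℝ} (hU : Uᵀ * U = 1) (hsym : ((1 + E) * Uᵀ)ᵀ = (1 + E) * Uᵀ)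
    (hpsd : ∀ w : o → ℝ, 0 ≤ w ⬝ᵥ (((1 + E) * Uᵀ) *ᵥ w)) : ‖U - 1‖ ≤ 1 / 2 * ‖E - Eᵀ‖ + 4 * ‖E‖ ^ 2 := by
  have ha : ‖U - 1‖ ≤ 2 * ‖E‖ := by
    have h := frob_norm_sub_one_le_two_mul hU hsym hpsd
    rwa [add_sub_cancel_left] at h
  -- `2(U − 1) = (E − Eᵀ) + (E(U−1)ᵀ − (U−1)Eᵀ) − (U−1)ᵀ(U−1)`
  have e : (2 : ℝ) • (U - 1) = (E - Eᵀ) + (E * (U - 1)ᵀ - (U - 1) * Eᵀ) - (U - 1)ᵀ * (U - 1) := by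
    have hs : U + U * Eᵀ = Uᵀ + E * Uᵀ := by
      have h := hsym
      rw [transpose_mul, transpose_transpose, transpose_add, transpose_one, Matrix.add_mul, Matrix.one_mul, Matrix.mul_add,
        Matrix.mul_one] at h
      exact h
    rw [transpose_sub, transpose_one, two_smul]
    have : Uᵀ * U = 1 := hU
    -- expand and use `hs`, `hU`
    have key : (E - Eᵀ) + (E * (Uᵀ - 1) - (U - 1) * Eᵀ) - (Uᵀ - 1) * (U - 1) =
        (U - 1) + (U - 1) + ((Uᵀ + E * Uᵀ) - (U + U * Eᵀ)) - (Uᵀ * U - 1) := by noncomm_ring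
    rw [key, hs, this, sub_self, sub_self, add_zero, sub_zero]
  have hn : 2 * ‖U - 1‖ ≤ ‖E - Eᵀ‖ + 2 * (‖E‖ * ‖U - 1‖) + ‖U - 1‖ ^ 2 := by
    have h2 : ‖(2 : ℝ) • (U - 1)‖ = 2 * ‖U - 1‖ := by rw [norm_smul, Real.norm_eq_abs, abs_of_pos two_pos]
    rw [← h2, e]
    have h3 : ‖E * (U - 1)ᵀ‖ ≤ ‖E‖ * ‖U - 1‖ := (norm_mul_le _ _).trans (by rw [Matrix.frobenius_norm_transpose])
    have h4 : ‖(U - 1) * Eᵀ‖ ≤ ‖E‖ * ‖U - 1‖ := (norm_mul_le _ _).trans (by rw [Matrix.frobenius_norm_transpose, mul_comm])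
    have h5 : ‖(U - 1)ᵀ * (U - 1)‖ ≤ ‖U - 1‖ ^ 2 := by
      rw [sq]; exact (norm_mul_le _ _).trans (by rw [Matrix.frobenius_norm_transpose])
    have h6 := norm_sub_le (E * (U - 1)ᵀ) ((U - 1) * Eᵀ)
    have h7 := norm_add_le (E - Eᵀ) (E * (U - 1)ᵀ - (U - 1) * Eᵀ)
    have h8 := norm_sub_le ((E - Eᵀ) + (E * (U - 1)ᵀ - (U - 1) * Eᵀ)) ((U - 1)ᵀ * (U - 1))
    linarith
  have hE := norm_nonneg E
  have hY := norm_nonneg (U - 1)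
  nlinarith

/-! ## §3 Base change: the polar link against any orthogonal link -/

/-- **`frob_norm_polar_sub_le_two_mul`** [our proof]: `R′` orthogonal with `M·R′ᵀ` symmetric positive semidefinite (the polar link of `M`, PART 58) and
`R_B` orthogonal ⟹ `‖R′ − R_B‖ ≤ 2·‖M·R_Bᵀ − 1‖`. -/
theorem frob_norm_polar_sub_le_two_mul {M R' RB : Matrix o o ℝ} (hR' : R'ᵀ * R' = 1) (hsym : (M * R'ᵀ)ᵀ = M * R'ᵀ)
    (hpsd : ∀ w : o → ℝ, 0 ≤ w ⬝ᵥ ((M * R'ᵀ) *ᵥ w)) (hRB : RBᵀ * RB = 1) : ‖R' - RB‖ ≤ 2 * ‖M * RBᵀ - 1‖ := by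
  have hRB' : RB * RBᵀ = 1 := mul_eq_one_comm.mp hRB
  -- `U := R′R_Bᵀ`, `G := MR_Bᵀ`
  have hU : (R' * RBᵀ)ᵀ * (R' * RBᵀ) = 1 := by
    rw [transpose_mul, transpose_transpose, Matrix.mul_assoc, ← Matrix.mul_assoc R'ᵀ, hR', Matrix.one_mul, hRB']
  have hGU : M * RBᵀ * (R' * RBᵀ)ᵀ = M * R'ᵀ := by
    rw [transpose_mul, transpose_transpose, Matrix.mul_assoc, ← Matrix.mul_assoc RBᵀ, hRB, Matrix.one_mul]
  have h := frob_norm_sub_one_le_two_mul (G := M * RBᵀ) hU (by rw [hGU]; exact hsym) (by rw [hGU]; exact hpsd)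
  have e : R' - RB = (R' * RBᵀ - 1) * RB := by rw [Matrix.sub_mul, Matrix.one_mul, Matrix.mul_assoc, hRB, Matrix.mul_one]
  rwa [e, frob_norm_mul_orthogonal _ hRB']

/-- **`frob_norm_polar_sub_le` — THE POLAR LINK AGAINST A SECOND ORTHOGONAL LINK** [our proof]: `R′` orthogonal with `M·R′ᵀ` symmetric positive
semidefinite, `R_B` orthogonal, `E = M·R_Bᵀ − 1` ⟹ `‖R′ − R_B‖ ≤ ½·‖E − Eᵀ‖ + 4·‖E‖²`. -/
theorem frob_norm_polar_sub_le {M R' RB E : Matrix o o ℝ} (hR' : R'ᵀ * R' = 1) (hsym : (M * R'ᵀ)ᵀ = M * R'ᵀ)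
    (hpsd : ∀ w : o → ℝ, 0 ≤ w ⬝ᵥ ((M * R'ᵀ) *ᵥ w)) (hRB : RBᵀ * RB = 1) (hE : E = M * RBᵀ - 1) :
    ‖R' - RB‖ ≤ 1 / 2 * ‖E - Eᵀ‖ + 4 * ‖E‖ ^ 2 := by
  have hRB' : RB * RBᵀ = 1 := mul_eq_one_comm.mp hRB
  have hU : (R' * RBᵀ)ᵀ * (R' * RBᵀ) = 1 := by
    rw [transpose_mul, transpose_transpose, Matrix.mul_assoc, ← Matrix.mul_assoc R'ᵀ, hR', Matrix.one_mul, hRB']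
  have hGU : (1 + E) * (R' * RBᵀ)ᵀ = M * R'ᵀ := by
    rw [hE, add_sub_cancel, transpose_mul, transpose_transpose, Matrix.mul_assoc, ← Matrix.mul_assoc RBᵀ, hRB, Matrix.one_mul]
  have h := frob_norm_sub_one_le_skew_add_sq (E := E) hU (by rw [hGU]; exact hsym) (by rw [hGU]; exact hpsd)
  have e : R' - RB = (R' * RBᵀ - 1) * RB := by rw [Matrix.sub_mul, Matrix.one_mul, Matrix.mul_assoc, hRB, Matrix.mul_one]
  rwa [e, frob_norm_mul_orthogonal _ hRB']

/-- **`mulVec_polar_sub_sq_le` — PART 56's LETTER SHAPE** [our proof]: under the hypotheses of `frob_norm_polar_sub_le`, for every `w`: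
`|(R′ − R_B)·w|² ≤ (½·‖E − Eᵀ‖ + 4·‖E‖²)²·|w|²` (the `hτ` letter of `covJensen_transfer` with `τ = ½‖E − Eᵀ‖ + 4‖E‖²`). -/
theorem mulVec_polar_sub_sq_le {M R' RB E : Matrix o o ℝ} (hR' : R'ᵀ * R' = 1) (hsym : (M * R'ᵀ)ᵀ = M * R'ᵀ)
    (hpsd : ∀ w : o → ℝ, 0 ≤ w ⬝ᵥ ((M * R'ᵀ) *ᵥ w)) (hRB : RBᵀ * RB = 1) (hE : E = M * RBᵀ - 1) (w : o → ℝ) :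
    ((R' - RB) *ᵥ w) ⬝ᵥ ((R' - RB) *ᵥ w) ≤ (1 / 2 * ‖E - Eᵀ‖ + 4 * ‖E‖ ^ 2) ^ 2 * (w ⬝ᵥ w) := by
  have h := frob_norm_polar_sub_le hR' hsym hpsd hRB hE
  refine (mulVec_dotProduct_self_le_frob (R' - RB) w).trans (mul_le_mul_of_nonneg_right ?_ ?_)
  · exact pow_le_pow_left₀ (norm_nonneg _) h 2
  · simpa only [dotProduct, sq] using Finset.sum_nonneg fun i _ => mul_self_nonneg (w i)

end Summit.QuantumFields.BalabanUV.Beta.GAN24.DerivativeRateTransferJensenMassFreePolarNear
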